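import Summits.ResolutionOfSingularities.ResolutionOfSingularities.Theorems.PurelyInseparableDim4ChartCentreTwist
import Summits.ResolutionOfSingularities.ResolutionOfSingularities.Theorems.PurelyInseparableDim4CentreAdmissible
import Literature.AlgebraicGeometry.Resolution.BlowupSequencesExtendOpen
import Literature.AlgebraicGeometry.Resolution.BlowupRestrictOpen
import Literature.AlgebraicGeometry.Hironaka2017.Lib.AffineCoordBlowupLSB
import HarnessLib

/-!
# Purely inseparable four-folds `z^p + F(x₁, …, x₄)`: WHEN THE WALK'S NEXT COORDINATE CENTRE IS A
# GLOBAL CENTRE — the re-centred chart centre `V(z, x_{S'})` is CLOSED in the blown-up ambient when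
# `S ∖ {j} ⊆ S'` (brick TY-2 (h) «chart chain, closedness criterion», cell `res-dim4-pi`)

[OURS · counted 0] (D-0157 DOOR 2; director-resolution DR-157-C; frame
`PIDim4.TerminationImpliesOrderReduction`, part S3 (c) «local branches ⇒ global sequence»; typ-3 memo
§B (c4) «GLOBAL centre for the next move … FALSE in general»). Sequel of
`PurelyInseparableDim4ChartCentreTwist.lean` (setting and notation there): `π : W → 𝔸⁵_K` ANY blowing
up along `V(z, x_S)`, `j ∈ S`, `Θ` a re-centring automorphism (`Θ z = z + h(x)`, `Θ xᵢ = xᵢ + bᵢ`,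
`b_j = 0`), `φ = Spec Θ ≫ chartImm : 𝔸⁵_K ⟶ W` the re-centred `x_j`-chart. To blow up the walk's next
centre `V(z, x_{S'}) ⊂ 𝔸⁵` (a closed subscheme of the OPEN chart) in the sense of BGMW
(`IsMultipleBlowup.blowup`: a centre on all of `W`), its image must be closed in `W`. PROVED here (no
`sorry`, no new axiom):

* §3 `support_twistColon_subset_opensRange` — the ideal sheaf
  `Q = (π^*(z − x_j G) : 𝓘_E) + Σ_{i ∈ S∖j} (π^*(xᵢ − bᵢ x_j) : 𝓘_E)` (`𝓘_E = π^*𝓘Λ_S`, `G` the twisted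
  cleaning polynomial) has support inside the `x_j`-chart: the principal charts of the twisted generators
  `z − x_j G`, `xᵢ − bᵢ x_j`, `x_j` of `(z, x_S)` cover `W` (`IsBlowup.iSup_blowupChart`) and `Q = 𝒪_W` on
  the first two kinds; `image_CΛ_subset_support_twistColon` — for `S ∖ {j} ⊆ S'`, `φ(V(z, x_{S'})) ⊆ V(Q)`
  (each colon piece pulls back into `(z, x_{S'})`); **`isClosed_image_CΛ_chart`** — hence
  `φ(V(z, x_{S'}))` is CLOSED in `W` (closure inside the chart, closed in the chart);
* §4 **the GLOBAL CENTRE** `Z = 𝓘(closure φ(V(z, x_{S'})))` (the tree's extension device,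
  `BlowupSequencesExtendOpen.lean`, Kollár Thm. 3.105 / BGMW Def. 3.1.5 Rem. (1)):
  `comap_globalCentre_chart` (`φ^* Z = 𝓘Λ 4 K Λ_{S'}`, no hypothesis on `S'`), and for `S ∖ {j} ⊆ S'`:
  `coe_support_globalCentre` (`V(Z) = φ(V(z, x_{S'}))`), `support_globalCentre_subset_opensRange`,
  `isRegular_globalCentre`, `hasSNCWith_globalCentre` (from `HasSNC E` on `W` and the snc of `φ^*E`
  with `V(z, x_{S'})` on the chart), `support_globalCentre_subset_support` (inside `supp M` for any
  marked ideal `M` of multiplicity `p` on `W` reading `(z^p + F')·𝒪` on the chart with `V(z, x_{S'})`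
  Hironaka-permissible for `z^p + F'`) — i.e. conditions (1)–(2) of BGMW Def. 3.1.3 for `Z`.

What this says for the frame: after a blow-up along `V(z, x_S)` and an edge to `s₁` on the `x_j`-chart, a
next coordinate centre `S'` of the walk GLOBALISES VERBATIM as soon as `S.erase j ⊆ S'` (the point; any
centre inside the strict transforms of all the hyperplanes `xᵢ = bᵢ x_j`, `i ∈ S ∖ j`). The assembly into
a two-step `IsMultipleBlowup` with the chart-of-chart dictionary, and the converse («for `S.erase j ⊄ S'`
the chart centre is NOT closed in `W`» — centre escape), are the sequel `PurelyInseparableDim4ChartChain.lean`.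
Nothing here is a statement about resolution of singularities in dimension ≥ 4 / characteristic `p` (NOT
proved anywhere in this programme). bears_on: LADDER-RESOLUTION:D157-DOOR2 (res-dim4-pi). Supports
stmt-ResolutionOfSingularities-16155 (helper, TY-2 (h)).
-/

-- every declaration of this summit lives under `Summit.ResolutionOfSingularities.ResolutionOfSingularities`
-- (summit = problem), which the duplicate-namespace linter flags; house convention (cf. the Target file).
set_option linter.dupNamespace false

noncomputable section

open MvPolynomial Finset CategoryTheory AlgebraicGeometry Opposite TopologicalSpace
open AlgebraicGeometry.Scheme.IdealSheafData (ofIdealTop vanishingIdeal)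

namespace Summit.ResolutionOfSingularities.ResolutionOfSingularities.Theorems.PIDim4

open Literature.AlgebraicGeometry.Resolution
open Literature.AlgebraicGeometry.Resolution.AffinePointBlowup (P A γ coord Wtop)

namespace ChartDictionary

/-! ## §3 The re-centred chart centre `φ(V(z, x_{S'}))` is closed in `W` when `S ∖ {j} ⊆ S'` -/

section Closed

variable {K : Type} [Field K] {S S' : Finset (Fin 4)} {j : Fin 4} {b : Fin 4 → K}
  {Θ : A 4 K ≃ₐ[K] A 4 K} {h : MvPolynomial (Fin 4) K} {W : Scheme.{0}} {π : W ⟶ P 4 K}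

/-- The inverse image along the re-centred chart `Spec Θ ≫ chartImm` of a pulled-back principal ideal
sheaf `π^*(γ⁻¹ a · 𝒪)` is the principal ideal sheaf of `Θ(ψ(a))` (`ψ` the chart substitution). -/
theorem comap_comap_ofIdealTop_chart (hj : j ∈ S) (Θr : A 4 K →+* A 4 K)
    (hπ : IsBlowup π (AffineCoordBlowup.𝓘Λ 4 K (insert 0 (Fin.succ '' (S : Set (Fin 4)))))) (a : A 4 K) :
    (((ofIdealTop (Ideal.span {(γ 4 K).symm a})).comap π).comap
        (Spec.map (CommRingCat.ofHom Θr) ≫ AffineCoordBlowup.chartImm hπ (succ_mem_centreVars hj))) =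
      ofIdealTop (Ideal.span {(γ 4 K).symm
        (Θr (coordBlowupSubst K (insert 0 (Fin.succ '' (S : Set (Fin 4)))) j.succ a))}) := by
  rw [Scheme.IdealSheafData.comap_comp,
    ← Scheme.IdealSheafData.comap_comp _ (AffineCoordBlowup.chartImm hπ (succ_mem_centreVars hj)) π,
    AffineCoordBlowup.chartImm_comp hπ (succ_mem_centreVars hj), comap_ofIdealTop_span_γ_symm,
    comap_ofIdealTop_span_γ_symm]
  rfl

/-- On `𝔸⁵`: `ofIdealTop (γ⁻¹ a) ≤ 𝓘Λ 4 K Λ` as soon as `a ∈ I_Λ`. -/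
theorem ofIdealTop_span_le_𝓘Λ {Λ : Set (Fin (4 + 1))} {a : A 4 K} (ha : a ∈ AffineCoordBlowup.IΛ 4 K Λ) :
    ofIdealTop (Ideal.span {(γ 4 K).symm a}) ≤ AffineCoordBlowup.𝓘Λ 4 K Λ := by
  refine Scheme.IdealSheafData.le_of_isAffine ?_
  change (ofIdealTop (Ideal.span {(γ 4 K).symm a})).ideal (Wtop 4 K) ≤
    (AffineCoordBlowup.𝓘Λ 4 K Λ).ideal (Wtop 4 K)
  rw [ideal_ofIdealTop_top, AffineCoordBlowup.ideal_𝓘Λ_top, ← AffineCoordBlowup.map_symm_IΛ,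
    Ideal.span_singleton_le_iff_mem]
  exact Ideal.mem_map_of_mem _ ha

/-- **The colon piece of a twisted generator, read on the re-centred chart, lies in the next centre
ideal.** If `Θ(ψ(a)) = x_j · a'` with `a' ∈ I_{Λ'}`, then
`φ^* (π^*(γ⁻¹a·𝒪) : 𝓘_E) = (γ⁻¹ a'·𝒪) ≤ 𝓘Λ 4 K Λ'` (`φ = Spec Θ ≫ chartImm`, `𝓘_E = π^*𝓘Λ_S`). -/
theorem comap_colon_piece_le (hj : j ∈ S) (hΘj : (Θ : A 4 K →+* A 4 K) (X j.succ) = X j.succ)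
    (hπ : IsBlowup π (AffineCoordBlowup.𝓘Λ 4 K (insert 0 (Fin.succ '' (S : Set (Fin 4))))))
    {Λ' : Set (Fin (4 + 1))} {a a' : A 4 K}
    (hmul : Θ (coordBlowupSubst K (insert 0 (Fin.succ '' (S : Set (Fin 4)))) j.succ a) = X j.succ * a')
    (ha' : a' ∈ AffineCoordBlowup.IΛ 4 K Λ') :
    (colon ((ofIdealTop (Ideal.span {(γ 4 K).symm a})).comap π)
        ((AffineCoordBlowup.𝓘Λ 4 K (insert 0 (Fin.succ '' (S : Set (Fin 4))))).comap π)).comap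
      (Spec.map (CommRingCat.ofHom (Θ : A 4 K →+* A 4 K)) ≫
        AffineCoordBlowup.chartImm hπ (succ_mem_centreVars hj)) ≤
      AffineCoordBlowup.𝓘Λ 4 K Λ' := by
  haveI : IsProper π := hπ.isProper
  haveI : IsLocallyNoetherian W := LocallyOfFiniteType.isLocallyNoetherian π
  haveI : IsIso (CommRingCat.ofHom (Θ : A 4 K →+* A 4 K)) :=
    (inferInstance : IsIso Θ.toRingEquiv.toCommRingCatIso.hom)
  rw [comap_colon_of_flat, comap_comap_ofIdealTop_chart hj (Θ : A 4 K →+* A 4 K) hπ a,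
    comap_exceptional_chart hj hΘj hπ, colon_ofIdealTop,
    show (Θ : A 4 K →+* A 4 K) (coordBlowupSubst K (insert 0 (Fin.succ '' (S : Set (Fin 4)))) j.succ a) =
      X j.succ * a' from hmul, map_mul]
  change ofIdealTop ((Ideal.span {coord 4 K j.succ * (γ 4 K).symm a'}).colon
    ((Ideal.span {coord 4 K j.succ} : Ideal Γ(P 4 K, Wtop 4 K)) : Set Γ(P 4 K, Wtop 4 K))) ≤ _
  rw [colon_span_singleton_mul_eq (mem_nonZeroDivisors_of_ne_zero (AffinePointBlowup.coord_ne_zero 4 K j.succ))]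
  exact ofIdealTop_span_le_𝓘Λ ha'

/-- **The support of the colon pieces of the twisted generators lies in the `x_j`-chart.** With
`𝓘_E = π^*𝓘Λ_S` and the twisted generators `z − x_j·G` (`G = h(σ x)`), `xᵢ − bᵢ x_j` (`i ∈ S ∖ j`)
of the centre ideal: the ideal sheaf `Q = (π^*(z − x_j G) : 𝓘_E) + Σᵢ (π^*(xᵢ − bᵢ x_j) : 𝓘_E)` has
support inside the re-centred `x_j`-chart `φ = Spec Θ ≫ chartImm` — the principal charts of the twisted
generators and of `x_j` cover `W` (`IsBlowup.iSup_blowupChart`), and on the former `Q = 𝒪_W`. -/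
theorem support_twistColon_subset_opensRange (hj : j ∈ S) (Θr : A 4 K →+* A 4 K) [IsIso (CommRingCat.ofHom Θr)]
    (hπ : IsBlowup π (AffineCoordBlowup.𝓘Λ 4 K (insert 0 (Fin.succ '' (S : Set (Fin 4))))))
    (Gt : A 4 K) :
    ((colon ((ofIdealTop (Ideal.span {(γ 4 K).symm (X 0 - X j.succ * Gt)})).comap π)
          ((AffineCoordBlowup.𝓘Λ 4 K (insert 0 (Fin.succ '' (S : Set (Fin 4))))).comap π) ⊔
        ⨆ i ∈ S.erase j, colon ((ofIdealTop (Ideal.span {(γ 4 K).symm (X i.succ - C (b i) * X j.succ)})).comap π)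
          ((AffineCoordBlowup.𝓘Λ 4 K (insert 0 (Fin.succ '' (S : Set (Fin 4))))).comap π)).support :
        Set W) ⊆
      (Spec.map (CommRingCat.ofHom Θr) ≫ AffineCoordBlowup.chartImm hπ (succ_mem_centreVars hj)).opensRange := by
  classical
  haveI : IsProper π := hπ.isProper
  haveI : IsLocallyNoetherian W := LocallyOfFiniteType.isLocallyNoetherian π
  rw [Scheme.Hom.opensRange_comp_of_isIso, AffineCoordBlowup.opensRange_chartImm hπ (succ_mem_centreVars hj)]
  -- the twisted generators, as sections over `⊤`, generate `𝓘Λ(⊤)`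
  have hspan : Ideal.span (Set.range (Subtype.val :
      ↥((γ 4 K).symm '' (insert (X 0 - X j.succ * Gt) (insert (X j.succ)
        ((fun i : Fin 4 => (X i.succ - C (b i) * X j.succ : A 4 K)) '' (S.erase j : Set (Fin 4)))))) →
        Γ(P 4 K, Wtop 4 K))) =
      (AffineCoordBlowup.𝓘Λ 4 K (insert 0 (Fin.succ '' (S : Set (Fin 4))))).ideal (Wtop 4 K) := by
    rw [Subtype.range_coe, AffineCoordBlowup.ideal_𝓘Λ_top, ← AffineCoordBlowup.map_symm_IΛ,
      ← span_twist_eq_IΛ S hj b Gt, Ideal.map_span]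
    rfl
  have hcover := hπ.iSup_blowupChart _ hspan
  intro w hw
  have hwtop : w ∈ π ⁻¹ᵁ ((Wtop 4 K : (P 4 K).Opens)) := trivial
  rw [← hcover, Opens.mem_iSup] at hwtop
  obtain ⟨⟨u, hu⟩, hwu⟩ := hwtop
  obtain ⟨a, ha, rfl⟩ := hu
  rcases ha with rfl | rfl | ⟨i, hi, rfl⟩
  · -- the principal chart of `z − x_j G`: the first colon piece is the unit ideal there
    exact absurd (Scheme.IdealSheafData.support_antitone le_sup_left hw)
      (not_mem_support_colon_of_mem_blowupChart hwu)
  · -- the principal chart of `x_j` IS the `x_j`-chart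
    exact hwu
  · -- the principal chart of `xᵢ − bᵢ x_j`
    refine absurd (Scheme.IdealSheafData.support_antitone (le_sup_right.trans' ?_) hw)
      (not_mem_support_colon_of_mem_blowupChart hwu)
    exact le_iSup₂ (f := fun i (_ : i ∈ S.erase j) =>
      colon ((ofIdealTop (Ideal.span {(γ 4 K).symm (X i.succ - C (b i) * X j.succ)})).comap π)
        ((AffineCoordBlowup.𝓘Λ 4 K (insert 0 (Fin.succ '' (S : Set (Fin 4))))).comap π)) i hi

/-- **The re-centred chart centre lies in the support of `Q`.** For `Θ z = z + h(x)`, `Θ xᵢ = xᵢ + bᵢ`,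
`b_j = 0`, `S ∖ {j} ⊆ S'` and `G = h(σ x)` the twisted cleaning polynomial: pulled back along
`φ = Spec Θ ≫ chartImm`, every colon piece of `Q` lies in `𝓘Λ 4 K Λ_{S'}`, so `φ(V(z, x_{S'})) ⊆ V(Q)`. -/
theorem image_CΛ_subset_support_twistColon (hj : j ∈ S) (hbj : b j = 0)
    (h0 : Θ (X 0) = X 0 + rename Fin.succ h) (hs : ∀ i : Fin 4, Θ (X i.succ) = X i.succ + C (b i))
    (hπ : IsBlowup π (AffineCoordBlowup.𝓘Λ 4 K (insert 0 (Fin.succ '' (S : Set (Fin 4))))))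
    (hS' : S.erase j ⊆ S') :
    (Spec.map (CommRingCat.ofHom (Θ : A 4 K →+* A 4 K)) ≫ AffineCoordBlowup.chartImm hπ (succ_mem_centreVars hj)) ''
        (AffineCoordBlowup.CΛ 4 K (insert 0 (Fin.succ '' (S' : Set (Fin 4)))) : Set (P 4 K)) ⊆
      ((colon ((ofIdealTop (Ideal.span {(γ 4 K).symm (X 0 - X j.succ * rename Fin.succ
            (aeval (fun k => if k ∈ S' then (0 : MvPolynomial (Fin 4) K) else X k - C (b k)) h))})).comap π)
          ((AffineCoordBlowup.𝓘Λ 4 K (insert 0 (Fin.succ '' (S : Set (Fin 4))))).comap π) ⊔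
        ⨆ i ∈ S.erase j, colon ((ofIdealTop (Ideal.span {(γ 4 K).symm (X i.succ - C (b i) * X j.succ)})).comap π)
          ((AffineCoordBlowup.𝓘Λ 4 K (insert 0 (Fin.succ '' (S : Set (Fin 4))))).comap π)).support :
        Set W) := by
  classical
  set φ := Spec.map (CommRingCat.ofHom (Θ : A 4 K →+* A 4 K)) ≫
    AffineCoordBlowup.chartImm hπ (succ_mem_centreVars hj) with hφ
  set Q := colon ((ofIdealTop (Ideal.span {(γ 4 K).symm (X 0 - X j.succ * rename Fin.succ
            (aeval (fun k => if k ∈ S' then (0 : MvPolynomial (Fin 4) K) else X k - C (b k)) h))})).comap π)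
          ((AffineCoordBlowup.𝓘Λ 4 K (insert 0 (Fin.succ '' (S : Set (Fin 4))))).comap π) ⊔
        ⨆ i ∈ S.erase j, colon ((ofIdealTop (Ideal.span {(γ 4 K).symm (X i.succ - C (b i) * X j.succ)})).comap π)
          ((AffineCoordBlowup.𝓘Λ 4 K (insert 0 (Fin.succ '' (S : Set (Fin 4))))).comap π) with hQ
  have hΘj : (Θ : A 4 K →+* A 4 K) (X j.succ) = X j.succ := by
    rw [show (Θ : A 4 K →+* A 4 K) (X j.succ) = Θ (X j.succ) from rfl, hs j, hbj, C_0, add_zero]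
  -- every colon piece pulls back into `𝓘Λ_{S'}`
  have hle : Q.comap φ ≤ AffineCoordBlowup.𝓘Λ 4 K (insert 0 (Fin.succ '' (S' : Set (Fin 4)))) := by
    rw [hQ, Scheme.IdealSheafData.comap_sup, sup_le_iff]
    refine ⟨comap_colon_piece_le hj hΘj hπ (clean_subst_X_zero_sub hS' hbj h0 hs)
      (X_zero_add_rename_sub_mem_IΛ S' h), ?_⟩
    rw [(Scheme.IdealSheafData.map_gc φ).l_iSup]
    refine iSup_le fun i => ?_
    rw [(Scheme.IdealSheafData.map_gc φ).l_iSup]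
    refine iSup_le fun hi => ?_
    obtain ⟨hij, hiS⟩ := Finset.mem_erase.mp hi
    exact comap_colon_piece_le hj hΘj hπ (clean_subst_X_sub S hiS hij hbj hs)
      (Ideal.subset_span ⟨i.succ, Set.mem_insert_of_mem _ ⟨i, hS' hi, rfl⟩, rfl⟩)
  -- hence `V(z, x_{S'}) ⊆ V(φ^* Q) = φ⁻¹ V(Q)`
  have hCΛ : AffineCoordBlowup.CΛ 4 K (insert 0 (Fin.succ '' (S' : Set (Fin 4)))) ≤ (Q.comap φ).support :=
    Scheme.IdealSheafData.le_support_iff_le_vanishingIdeal.mpr hle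
  rintro _ ⟨y, hy, rfl⟩
  have h2 : y ∈ (Q.comap φ).support := hCΛ hy
  rw [Scheme.IdealSheafData.support_comap] at h2
  exact h2

/-- **CLOSEDNESS CRITERION (sufficiency).** Let `π : W → 𝔸⁵_K` be any blowing up along `V(z, x_S)`,
`j ∈ S`, `Θ` a re-centring automorphism of `K[z, x]` (`Θ z = z + h(x)`, `Θ xᵢ = xᵢ + bᵢ`, `b_j = 0` — the
shape of the chart dictionary's translation-and-cleaning), and `S' ⊇ S ∖ {j}`. Then the image of the
coordinate subspace `V(z, x_{S'})` under the re-centred chart `Spec Θ ≫ chartImm : 𝔸⁵_K ⟶ W` is CLOSED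
in `W`: the walk's next centre is (the restriction of) a global centre. -/
theorem isClosed_image_CΛ_chart (hj : j ∈ S) (hbj : b j = 0)
    (h0 : Θ (X 0) = X 0 + rename Fin.succ h) (hs : ∀ i : Fin 4, Θ (X i.succ) = X i.succ + C (b i))
    (hπ : IsBlowup π (AffineCoordBlowup.𝓘Λ 4 K (insert 0 (Fin.succ '' (S : Set (Fin 4))))))
    (hS' : S.erase j ⊆ S') :
    IsClosed ((Spec.map (CommRingCat.ofHom (Θ : A 4 K →+* A 4 K)) ≫
        AffineCoordBlowup.chartImm hπ (succ_mem_centreVars hj)) ''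
      (AffineCoordBlowup.CΛ 4 K (insert 0 (Fin.succ '' (S' : Set (Fin 4)))) : Set (P 4 K))) := by
  haveI : IsIso (CommRingCat.ofHom (Θ : A 4 K →+* A 4 K)) :=
    (inferInstance : IsIso Θ.toRingEquiv.toCommRingCatIso.hom)
  -- `φ(C') ⊆ V(Q) ⊆ x_j-chart = range φ`
  have h1 := image_CΛ_subset_support_twistColon hj hbj h0 hs hπ hS'
  have h2 := support_twistColon_subset_opensRange (b := b) hj (Θ : A 4 K →+* A 4 K) hπ
    (rename Fin.succ (aeval (fun k => if k ∈ S' then (0 : MvPolynomial (Fin 4) K) else X k - C (b k)) h))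
  have hcl : closure ((Spec.map (CommRingCat.ofHom (Θ : A 4 K →+* A 4 K)) ≫
        AffineCoordBlowup.chartImm hπ (succ_mem_centreVars hj)) ''
      (AffineCoordBlowup.CΛ 4 K (insert 0 (Fin.succ '' (S' : Set (Fin 4)))) : Set (P 4 K))) ⊆
      Set.range (Spec.map (CommRingCat.ofHom (Θ : A 4 K →+* A 4 K)) ≫
        AffineCoordBlowup.chartImm hπ (succ_mem_centreVars hj)) := by
    refine ((Scheme.IdealSheafData.support _).isClosed.closure_subset_iff.mpr h1).trans fun w hw => ?_
    exact h2 hw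
  -- an open immersion is an embedding: a subset with closure inside the range is closed iff closed in `𝔸⁵`
  have hind := (Spec.map (CommRingCat.ofHom (Θ : A 4 K →+* A 4 K)) ≫
    AffineCoordBlowup.chartImm hπ (succ_mem_centreVars hj)).isOpenEmbedding.isInducing.closure_eq_preimage_closure_image
    (AffineCoordBlowup.CΛ 4 K (insert 0 (Fin.succ '' (S' : Set (Fin 4)))) : Set (P 4 K))
  rw [(AffineCoordBlowup.CΛ 4 K (insert 0 (Fin.succ '' (S' : Set (Fin 4))))).isClosed.closure_eq] at hind
  have heq : (Spec.map (CommRingCat.ofHom (Θ : A 4 K →+* A 4 K)) ≫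
        AffineCoordBlowup.chartImm hπ (succ_mem_centreVars hj)) ''
      (AffineCoordBlowup.CΛ 4 K (insert 0 (Fin.succ '' (S' : Set (Fin 4)))) : Set (P 4 K)) =
      closure ((Spec.map (CommRingCat.ofHom (Θ : A 4 K →+* A 4 K)) ≫
        AffineCoordBlowup.chartImm hπ (succ_mem_centreVars hj)) ''
      (AffineCoordBlowup.CΛ 4 K (insert 0 (Fin.succ '' (S' : Set (Fin 4)))) : Set (P 4 K))) := by
    nth_rewrite 1 [hind]
    rw [Set.image_preimage_eq_inter_range, Set.inter_eq_left.mpr hcl]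
  rw [heq]
  exact isClosed_closure

end Closed

/-! ## §4 The global centre `𝓘(closure φ(V(x_Λ')))` of a coordinate subspace seen in an affine chart -/

section GlobalCentre

variable {K : Type} [Field K] {Z : Scheme.{0}} (φ : P 4 K ⟶ Z) [IsOpenImmersion φ]

omit [IsOpenImmersion φ] in
/-- The reduced ideal sheaf `𝓘Λ` of a coordinate subspace is radical. -/
theorem radical_𝓘Λ (Λ : Set (Fin (4 + 1))) :
    (AffineCoordBlowup.𝓘Λ 4 K Λ).radical = AffineCoordBlowup.𝓘Λ 4 K Λ := by
  rw [← Scheme.IdealSheafData.vanishingIdeal_support, AffineCoordBlowup.support_𝓘Λ]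
  rfl

/-- **The global centre restricts to the chart centre**: for ANY open immersion `φ : 𝔸⁵_K ⟶ Z` (e.g. the
re-centred chart `Spec Θ ≫ chartImm`) and any set of coordinates `Λ'`,
`φ^* 𝓘(closure φ(V(x_Λ'))) = 𝓘Λ 4 K Λ'` (an open immersion is an embedding; `𝓘Λ` is radical). No closedness
hypothesis is needed here. -/
theorem comap_globalCentre (Λ' : Set (Fin (4 + 1))) :
    (vanishingIdeal (closureImage φ ((AffineCoordBlowup.𝓘Λ 4 K Λ').support : Set (P 4 K)))).comap φ =
      AffineCoordBlowup.𝓘Λ 4 K Λ' :=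
  comap_vanishingIdeal_closureImage_support φ (radical_𝓘Λ Λ')

omit [IsOpenImmersion φ] in
/-- **The support of the global centre is the image of the chart centre**, as soon as that image is closed
(for the re-centred chart after a blow-up along `V(z, x_S)`: `isClosed_image_CΛ_chart`, `S ∖ {j} ⊆ S'`). -/
theorem coe_support_globalCentre {Λ' : Set (Fin (4 + 1))}
    (hT : IsClosed (φ '' (AffineCoordBlowup.CΛ 4 K Λ' : Set (P 4 K)))) :
    ((vanishingIdeal (closureImage φ ((AffineCoordBlowup.𝓘Λ 4 K Λ').support : Set (P 4 K)))).support : Set Z) =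
      φ '' (AffineCoordBlowup.CΛ 4 K Λ' : Set (P 4 K)) := by
  rw [Scheme.IdealSheafData.coe_support_vanishingIdeal, coe_closureImage, AffineCoordBlowup.support_𝓘Λ, hT.closure_eq]

omit [IsOpenImmersion φ] in
/-- The global centre is supported inside the chart. -/
theorem support_globalCentre_subset_range {Λ' : Set (Fin (4 + 1))}
    (hT : IsClosed (φ '' (AffineCoordBlowup.CΛ 4 K Λ' : Set (P 4 K)))) :
    ((vanishingIdeal (closureImage φ ((AffineCoordBlowup.𝓘Λ 4 K Λ').support : Set (P 4 K)))).support : Set Z) ⊆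
      Set.range φ := by
  rw [coe_support_globalCentre φ hT]
  exact Set.image_subset_range _ _

omit [IsOpenImmersion φ] in
/-- The chart centre lies over its (closed) image. -/
theorem support_𝓘Λ_subset_preimage_image (Λ' : Set (Fin (4 + 1))) :
    ((AffineCoordBlowup.𝓘Λ 4 K Λ').support : Set (P 4 K)) ⊆ φ ⁻¹' (φ '' (AffineCoordBlowup.CΛ 4 K Λ' : Set (P 4 K))) := by
  rw [AffineCoordBlowup.support_𝓘Λ]
  exact fun y hy => ⟨y, hy, rfl⟩

/-- **BGMW Def. 3.1.3, regularity of the centre**: the global centre is a regular scheme (it is isomorphic,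
along the open immersion `φ`, to the affine space `V(x_Λ')`; tree `isRegular_subscheme_vanishingIdeal_closureImage`
with `AffineCoordBlowupLSB.isRegular_CΛ`). -/
theorem isRegular_globalCentre [IsLocallyNoetherian Z] {Λ' : Set (Fin (4 + 1))}
    (hT : IsClosed (φ '' (AffineCoordBlowup.CΛ 4 K Λ' : Set (P 4 K)))) :
    Scheme.IsRegular (vanishingIdeal (closureImage φ
      ((AffineCoordBlowup.𝓘Λ 4 K Λ').support : Set (P 4 K)))).subscheme :=
  isRegular_subscheme_vanishingIdeal_closureImage φ
    (Literature.AlgebraicGeometry.Hironaka2017.Lib.AffineCoordBlowupLSB.isRegular_CΛ 4 K Λ') hT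
    (Set.image_subset_range _ _) (support_𝓘Λ_subset_preimage_image φ Λ')

/-- **BGMW Def. 3.1.3 (2), simple normal crossings with the boundary**: if `E` has simple normal crossings on
`Z` and, read on the chart, has simple normal crossings with `V(x_Λ')`, then `E` has simple normal crossings
with the global centre (tree `HasSNC.hasSNCWith_vanishingIdeal_closureImage`). -/
theorem hasSNCWith_globalCentre {Λ' : Set (Fin (4 + 1))}
    (hT : IsClosed (φ '' (AffineCoordBlowup.CΛ 4 K Λ' : Set (P 4 K)))) {E : List Z.IdealSheafData}
    (hE : HasSNC E) (hEc : HasSNCWith (E.map (·.comap φ)) (AffineCoordBlowup.𝓘Λ 4 K Λ')) :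
    HasSNCWith E (vanishingIdeal (closureImage φ ((AffineCoordBlowup.𝓘Λ 4 K Λ').support : Set (P 4 K)))) :=
  HasSNC.hasSNCWith_vanishingIdeal_closureImage φ hE (radical_𝓘Λ Λ') hEc hT (Set.image_subset_range _ _)
    (support_𝓘Λ_subset_preimage_image φ Λ')

/-- **BGMW Def. 3.1.3 (1), the centre lies in the support**: if a marked ideal `M` on `Z` of multiplicity `p`
reads `(z^p + F')·𝒪` on the chart and `V(z, x_{S'})` is Hironaka-permissible for `z^p + F'`
(`p ≤ ord_{(x_{S'})} F'`), then the global centre of `V(z, x_{S'})` lies in `supp M` (orders of ideals are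
read on the chart, `idealOrder_comap_of_isOpenImmersion`; there `le_idealOrder_hypSheaf_of_mem_CΛ`). -/
theorem support_globalCentre_subset_support [IsLocallyNoetherian Z] {S' : Finset (Fin 4)}
    (hT : IsClosed (φ '' (AffineCoordBlowup.CΛ 4 K (insert 0 (Fin.succ '' (S' : Set (Fin 4)))) : Set (P 4 K))))
    {p : ℕ} {M : MarkedIdeal Z} (hmult : M.mult = p) {F' : MvPolynomial (Fin 4) K}
    (hM : M.ideal.comap φ = hypSheaf p F') (hperm : (p : ℕ∞) ≤ CentreBlowup.ordAlong S' F') :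
    ((vanishingIdeal (closureImage φ ((AffineCoordBlowup.𝓘Λ 4 K
        (insert 0 (Fin.succ '' (S' : Set (Fin 4))))).support : Set (P 4 K)))).support : Set Z) ⊆ M.support := by
  rw [coe_support_globalCentre φ hT]
  rintro _ ⟨y, hy, rfl⟩
  change (M.mult : ℕ∞) ≤ idealOrder M.ideal _
  rw [hmult, ← idealOrder_comap_of_isOpenImmersion φ M.ideal y, hM]
  exact le_idealOrder_hypSheaf_of_mem_CΛ p S' F' hperm hy

/-- **The chart case, packaged (BGMW Def. 3.1.3 (1)–(2) for the second coordinate centre).** After a blowing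
up `π : W → 𝔸⁵_K` along `V(z, x_S)`, on the re-centred `x_j`-chart `φ = Spec Θ ≫ chartImm` (`Θ z = z + h(x)`,
`Θ xᵢ = xᵢ + bᵢ`, `b_j = 0`), for `S ∖ {j} ⊆ S'`: the global centre `Z` of `V(z, x_{S'})` restricts to
`𝓘Λ 4 K Λ_{S'}` on the chart, is supported in the chart, is regular, has simple normal crossings with every
snc boundary `E` of `W` whose restriction to the chart has snc with `V(z, x_{S'})`, and lies in the support of
every marked ideal of multiplicity `p` reading `(z^p + F')·𝒪` on the chart with `p ≤ ord_{(x_{S'})} F'`. -/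
theorem globalCentre_chart_package {S S' : Finset (Fin 4)} {j : Fin 4} {b : Fin 4 → K}
    {Θ : A 4 K ≃ₐ[K] A 4 K} {h : MvPolynomial (Fin 4) K} {W : Scheme.{0}} {π : W ⟶ P 4 K}
    (hj : j ∈ S) (hbj : b j = 0) (h0 : Θ (X 0) = X 0 + rename Fin.succ h)
    (hs : ∀ i : Fin 4, Θ (X i.succ) = X i.succ + C (b i))
    (hπ : IsBlowup π (AffineCoordBlowup.𝓘Λ 4 K (insert 0 (Fin.succ '' (S : Set (Fin 4)))))) (hS' : S.erase j ⊆ S') :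
    haveI : IsIso (CommRingCat.ofHom (Θ : A 4 K →+* A 4 K)) :=
      (inferInstance : IsIso Θ.toRingEquiv.toCommRingCatIso.hom)
    let φ := Spec.map (CommRingCat.ofHom (Θ : A 4 K →+* A 4 K)) ≫ AffineCoordBlowup.chartImm hπ (succ_mem_centreVars hj)
    let Zc := vanishingIdeal (closureImage φ ((AffineCoordBlowup.𝓘Λ 4 K
        (insert 0 (Fin.succ '' (S' : Set (Fin 4))))).support : Set (P 4 K)))
    Zc.comap φ = AffineCoordBlowup.𝓘Λ 4 K (insert 0 (Fin.succ '' (S' : Set (Fin 4)))) ∧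
      (Zc.support : Set W) ⊆ Set.range φ ∧ Scheme.IsRegular Zc.subscheme ∧
      (∀ E : List W.IdealSheafData, HasSNC E →
        HasSNCWith (E.map (·.comap φ)) (AffineCoordBlowup.𝓘Λ 4 K (insert 0 (Fin.succ '' (S' : Set (Fin 4))))) →
          HasSNCWith E Zc) ∧
      (∀ (p : ℕ) (M : MarkedIdeal W) (F' : MvPolynomial (Fin 4) K), M.mult = p → M.ideal.comap φ = hypSheaf p F' →
        (p : ℕ∞) ≤ CentreBlowup.ordAlong S' F' → (Zc.support : Set W) ⊆ M.support) := by
  haveI : IsIso (CommRingCat.ofHom (Θ : A 4 K →+* A 4 K)) :=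
    (inferInstance : IsIso Θ.toRingEquiv.toCommRingCatIso.hom)
  haveI : IsProper π := hπ.isProper
  haveI : IsLocallyNoetherian W := LocallyOfFiniteType.isLocallyNoetherian π
  have hT := isClosed_image_CΛ_chart hj hbj h0 hs hπ hS'
  exact ⟨comap_globalCentre _ _, support_globalCentre_subset_range _ hT, isRegular_globalCentre _ hT,
    fun E hE hEc => hasSNCWith_globalCentre _ hT hE hEc,
    fun p M F' hmult hM hperm => support_globalCentre_subset_support _ hT hmult hM hperm⟩

end GlobalCentre

end ChartDictionary

end Summit.ResolutionOfSingularities.ResolutionOfSingularities.Theorems.PIDim4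

end
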